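import Mathlib
import HarnessLib
import Summits.HubbardSuperconductivity.HubbardSuperconductivity.Theorems.KLProgrammeKLRegimeSplitTwoLegSizesMSChainTableTube
import Summits.HubbardSuperconductivity.HubbardSuperconductivity.Theorems.KLProgrammeKLRegimeSplitTwoLegSizesMSFitPiecesAux

/-!
# Route `KLProgramme`, crux K3 — (E3a-MS) supplier chain, TUBE RE-KEY (T4): the pieces-keyed, Λ-parametric suppliers with the increment-symbol
# sizes on the flat tube, and the explicit tube radius the chain needs (k3c3-p1 g4)

Seat hubbard-kl-k3c3-p1 (g4).  `…TwoLegSizesMSWithPiecesL` (p510466) re-keyed through `…MSChainTableTube`: the symbol sizes `hσ0/hσ/hε0/hε` are assumed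
only on `{q : |frameLevel μ K q| ≤ dT}`, and the table's two tube conditions are discharged from the pieces:

* `msTubeH R U n₀ := 8·Gfr₀|U|·(16^{n₀})⁻¹/15` bounds the sups of the not-yet-added high parts `Σ_{m ∈ Ioc n₀ N} msE d (pieceSize R U m) 0`
  (`sum_msE_zero_le_msTubeH`), and **`msTubeR R U n₀ G_l := msTubeH R U n₀ · (1 + G_l/klCurveD)`** adds the Lipschitz correction of the step
  segments (`tube_conditions_of_pieces`; `G_l` = a gradient bound of `frameLevel μ K`, `7` for an admissible frame);
* **`twoLegSizesMSWith_succ_of_pieces_L_tube`**, **`twoLegSizesMSWith_zero_of_pieces_L_tube`** — conclusions byte-identical to p510466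
  (`msPieceBaseL` / `msPieceSlotL`), hypotheses: tube sizes + `hGl` + `msTubeR R U n₀ G_l ≤ dT`.

Proofs only; nothing about the model.
-/

noncomputable section

namespace Summit.HubbardSuperconductivity.HubbardSuperconductivity.Theorems.KLRegimeSplit

set_option linter.dupNamespace false -- summit = problem name (single-conjunct summit), D-0017
set_option maxSynthPendingDepth 4 -- nested operator-norm instances (symbol sizes up to order five), as in `…CompDiff`

open Real Finset Literature.MathematicalPhysics.QuantumLattice Literature.MathematicalPhysics.QuantumLattice.FermiRG
open Literature.MathematicalPhysics.QuantumLattice.BandSectorCounting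
open Summit.HubbardSuperconductivity.HubbardSuperconductivity.Theorems.KLProgrammeLegKernels
open Summit.HubbardSuperconductivity.HubbardSuperconductivity.Theorems.DispersionFlow
open Summit.HubbardSuperconductivity.HubbardSuperconductivity.Theorems.PerturbedFermiCurve

/-! ## §1 The tube radius the chain needs -/

/-- The sups of the not-yet-added high parts below scale `n₀`: `8·Gfr₀|U|·(16^{n₀})⁻¹/15`. -/
def msTubeH (R : RenConsts) (U : ℝ) (n₀ : ℕ) : ℝ := 8 * R.Gfr 0 * |U| * (((16 : ℝ) ^ n₀)⁻¹ / 15)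

/-- **The tube radius of the chain at scale `n₀`**: high parts plus the Lipschitz correction of the step segments, `msTubeH · (1 + G_l/klCurveD)`. -/
def msTubeR (R : RenConsts) (U : ℝ) (n₀ : ℕ) (Gl : ℝ) : ℝ := msTubeH R U n₀ * (1 + Gl / klCurveD)

/-- `0 ≤ msTubeH`. -/
theorem msTubeH_nonneg {R : RenConsts} (hR : ∀ j, 0 ≤ R.Gfr j) (U : ℝ) (n₀ : ℕ) : 0 ≤ msTubeH R U n₀ := by
  have := hR 0; unfold msTubeH; positivity

/-- The high parts' order-zero sizes sum below `msTubeH`. -/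
theorem sum_msE_zero_le_msTubeH {R : RenConsts} (hR : ∀ j, 0 ≤ R.Gfr j) (U : ℝ) (d n₀ N : ℕ) :
    ∑ m ∈ Ioc n₀ N, msE d (pieceSize R U m) 0 ≤ msTubeH R U n₀ := by
  have h0 := hR 0
  calc ∑ m ∈ Ioc n₀ N, msE d (pieceSize R U m) 0 ≤ ∑ m ∈ Ioc n₀ N, 8 * R.Gfr 0 * |U| * ((16 : ℝ) ^ m)⁻¹ :=
        Finset.sum_le_sum fun m _ => by
          have h := msE_pieceSize_zero_le_contraction (R := R) U d m
          rw [← sixteen_pow_eq_four_sq] at h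
          simpa [div_eq_mul_inv] using h
    _ = 8 * R.Gfr 0 * |U| * ∑ m ∈ Ioc n₀ N, ((16 : ℝ) ^ m)⁻¹ := by rw [Finset.mul_sum]
    _ ≤ 8 * R.Gfr 0 * |U| * (((16 : ℝ) ^ n₀)⁻¹ / 15) :=
        mul_le_mul_of_nonneg_left (sum_Ioc_sixteen_inv_le n₀ N) (by positivity)
    _ = msTubeH R U n₀ := rfl

/-- **The table's two tube conditions from the pieces**: in the chain regime (`klCurveD ≤ Dt − 2A`), `msTubeR R U n₀ G_l ≤ dT` gives
`Σ e m 0 ≤ dT` and `Σ e m' 0 + G_l·msdD A A₃ A₄ Dt (e m) 0 ≤ dT` for every slot `m` (any `A₃ A₄`), `e m = msE d (pieceSize R U m)`. -/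
theorem tube_conditions_of_pieces {R : RenConsts} (hR : ∀ j, 0 ≤ R.Gfr j) (U : ℝ) (d : ℕ) {n₀ N : ℕ} {A Dt : ℝ}
    (hd : klCurveD ≤ Dt - 2 * A) {μ : ℝ} {K : TrigPolyC4v} {Gl : ℝ} (hGl : ∀ q : Momentum, ‖fderiv ℝ (frameLevel μ K) q‖ ≤ Gl)
    {dT : ℝ} (hdT : msTubeR R U n₀ Gl ≤ dT) :
    (∑ m ∈ Ioc n₀ N, msE d (pieceSize R U m) 0 ≤ dT) ∧
      ∀ m ∈ Ioc n₀ N, ∀ A₃ A₄ : ℝ,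
        ∑ m' ∈ Ioc n₀ N, msE d (pieceSize R U m') 0 + Gl * msdD A A₃ A₄ Dt (msE d (pieceSize R U m)) 0 ≤ dT := by
  have hGl0 : 0 ≤ Gl := (norm_nonneg _).trans (hGl 0)
  have hDpos := klCurveD_pos
  have hH := sum_msE_zero_le_msTubeH hR U d n₀ N
  have hH0 := msTubeH_nonneg hR U n₀
  have hR1 : msTubeH R U n₀ ≤ msTubeR R U n₀ Gl := by
    unfold msTubeR
    have : 0 ≤ Gl / klCurveD := by positivity
    nlinarith
  refine ⟨hH.trans (hR1.trans hdT), fun m hm A₃ A₄ => ?_⟩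
  have hDt : 0 < Dt - 2 * A := lt_of_lt_of_le hDpos hd
  have hem : msE d (pieceSize R U m) 0 ≤ msTubeH R U n₀ :=
    (Finset.single_le_sum (fun m' _ => msE_pieceSize_nonneg hR U d m' 0) hm).trans hH
  have hem0 : 0 ≤ msE d (pieceSize R U m) 0 := msE_pieceSize_nonneg hR U d m 0
  have hstep : msdD A A₃ A₄ Dt (msE d (pieceSize R U m)) 0 = msE d (pieceSize R U m) 0 / (Dt - 2 * A) := rfl
  have hfrac : msE d (pieceSize R U m) 0 / (Dt - 2 * A) ≤ msTubeH R U n₀ / klCurveD :=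
    div_le_div₀ hH0 hem hDpos hd
  rw [hstep]
  calc ∑ m' ∈ Ioc n₀ N, msE d (pieceSize R U m') 0 + Gl * (msE d (pieceSize R U m) 0 / (Dt - 2 * A))
      ≤ msTubeH R U n₀ + Gl * (msTubeH R U n₀ / klCurveD) := add_le_add hH (mul_le_mul_of_nonneg_left hfrac hGl0)
    _ = msTubeR R U n₀ Gl := by unfold msTubeR; ring
    _ ≤ dT := hdT

/-! ## §2 The suppliers with tube sizes -/

section MS

variable {L M : ℕ} [NeZero L] [NeZero M] {R : RenConsts} {β U μ : ℝ}

/-- **(E3a-MS), parametric, AT SCALE `n+1`, pieces-keyed, Λ-parametric, TUBE symbol sizes** — `twoLegSizesMSWith_succ_of_pieces_L` with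
`hσ0/hσ/hε0/hε` on `{|frameLevel μ K| ≤ dT}` and the one tube condition `msTubeR R U (n+1) G_l ≤ dT`. -/
theorem twoLegSizesMSWith_succ_of_pieces_L_tube (hR : ∀ j, 0 ≤ R.Gfr j) {c : ℝ} (hc : 0 < c) (hcle : c ≤ klCurveC3 R / 16)
    (hU : 0 < U) (hUle : U ≤ klCurveU0 R / 16) (hβmin : klBetaMin ≤ β) (hβc : β ≤ Real.exp (c / U ^ 2)) (hμ : μ ∈ klWindowC)
    {K : TrigPolyC4v} {Kp : ℕ → TrigPolyC4v} (hK : ∀ p : Fin 2 → ℝ, K.eval p = ∑ m ∈ range (nScales β + 1), (Kp m).eval p)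
    (ha : ∀ m ≤ nScales β, ∀ j ≤ 4, ∀ q : Momentum, ‖iteratedFDeriv ℝ j (evalM (Kp m)) q‖ ≤ pieceSize R U m j)
    {n : ℕ} (hn : n + 1 ≤ nScales β) (d : ℕ)
    {Λ₃ : ℝ} (hΛ₃ : ∀ q : Momentum, ∑ m ∈ Ioc (n + 1) (nScales β), ‖iteratedFDeriv ℝ 3 (evalM (lowPart d (Kp m))) q‖ ≤ Λ₃)
    {Λ₄ : ℝ} (hΛ₄ : ∀ q : Momentum, ∑ m ∈ Ioc (n + 1) (nScales β), ‖iteratedFDeriv ℝ 4 (evalM (lowPart d (Kp m))) q‖ ≤ Λ₄)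
    (hc₁ : Continuous (klLocalPart L M β U μ K (n + 1))) (hc₀ : Continuous (klLocalPart L M β U μ K n))
    {S : ℕ → TrigPolyC4v}
    (hS : ∀ θ, klLocalPart L M β U μ K (n + 1) θ - klLocalPart L M β U μ K n θ =
      (S (nScales β - (n + 1))).eval (klFermiPoint μ K θ))
    {dT : ℝ} {σ : ℕ → ℕ → ℝ} (hσnn : ∀ k l, 0 ≤ σ k l)
    (hσ0 : ∀ k ≤ nScales β - (n + 1), ∀ q : Momentum, |frameLevel μ K q| ≤ dT → |evalM (S k) q| ≤ σ k 0)
    (hσ : ∀ k ≤ nScales β - (n + 1), ∀ l, 1 ≤ l → l ≤ 5 → ∀ q : Momentum, |frameLevel μ K q| ≤ dT → ‖iteratedFDeriv ℝ l (evalM (S k)) q‖ ≤ σ k l)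
    {ε : ℕ → ℕ → ℝ} (hεnn : ∀ m l, 0 ≤ ε m l)
    (hε0 : ∀ m ∈ Ioc (n + 1) (nScales β), ∀ q : Momentum,
      |frameLevel μ K q| ≤ dT → |evalM (fsub (S (m - (n + 1))) (S (m - (n + 1) - 1))) q| ≤ ε m 0)
    (hε : ∀ m ∈ Ioc (n + 1) (nScales β), ∀ l, 1 ≤ l → l ≤ 4 → ∀ q : Momentum,
      |frameLevel μ K q| ≤ dT → ‖iteratedFDeriv ℝ l (evalM (fsub (S (m - (n + 1))) (S (m - (n + 1) - 1)))) q‖ ≤ ε m l)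
    {X : ℝ} (hX : ∀ l ≤ 4, ∀ x : ℝ, ‖iteratedFDeriv ℝ l salmhoferCutoff x‖ ≤ X)
    {Gl : ℝ} (hGl : ∀ q : Momentum, ‖fderiv ℝ (frameLevel μ K) q‖ ≤ Gl) (hdT : msTubeR R U (n + 1) Gl ≤ dT) :
    TwoLegSizesMSWith L M β U μ K.eval (n + 1) (msPieceBaseL X σ R U (n + 1) Λ₃ Λ₄) (msPieceSlotL X σ ε R c U d (n + 1) Λ₃ Λ₄) := by
  obtain ⟨-, hA20, hd, ⟨hlo, hhi⟩, -, -⟩ := chain_regime_of_pieces hR hc hcle hU hUle hβmin hβc hμ ha (n := n + 1) hn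
  have he : ∀ m ∈ Ioc (n + 1) (nScales β), ∀ j ≤ 4, ∀ q : Momentum,
      ‖iteratedFDeriv ℝ j (evalM (highPart d (Kp m))) q‖ ≤ msE d (pieceSize R U m) j :=
    fun m hm j hj q => norm_iteratedFDeriv_evalM_highPart_le_msE d (ha m (Finset.mem_Ioc.mp hm).2) hj q
  have hA : ∀ k ≤ nScales β - (n + 1), ∀ p : Momentum, ∀ j ≤ 2,
      ‖iteratedFDeriv ℝ j (frameShift (msChain d Kp (n + 1) (nScales β) k)) p‖ ≤ msA R c U :=
    fun k hk p j hj => norm_iteratedFDeriv_frameShift_msChain_le_msA d hn hR ha hc hcle hU hUle hβmin hβc hμ rfl hk p hj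
  obtain ⟨hdT0, hdT'⟩ := tube_conditions_of_pieces hR U d hd hGl hdT
  exact twoLegSizesMSWith_succ_of_chainF_table_tube hμ hK hn d hc₁ hc₀ hS hA hA20 hd hlo hhi
    (fun k hk k' hk' p => norm_iteratedFDeriv_three_frameShift_msChain_le_L d hn hR ha hΛ₃ hk hk' p)
    (fun k hk k' hk' p => norm_iteratedFDeriv_four_frameShift_msChain_le_L d hn hR ha hΛ₄ hk hk' p)
    hσnn hσ0 hσ hεnn hε0 hε he hX hGl hdT0 (fun m hm => hdT' m hm _ _)

/-- **(E3a-MS), parametric, AT SCALE `0`, pieces-keyed, Λ-parametric, TUBE symbol sizes** (`msTubeR R U 0 G_l ≤ dT`). -/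
theorem twoLegSizesMSWith_zero_of_pieces_L_tube (hR : ∀ j, 0 ≤ R.Gfr j) {c : ℝ} (hc : 0 < c) (hcle : c ≤ klCurveC3 R / 16)
    (hU : 0 < U) (hUle : U ≤ klCurveU0 R / 16) (hβmin : klBetaMin ≤ β) (hβc : β ≤ Real.exp (c / U ^ 2)) (hμ : μ ∈ klWindowC)
    {K : TrigPolyC4v} {Kp : ℕ → TrigPolyC4v} (hK : ∀ p : Fin 2 → ℝ, K.eval p = ∑ m ∈ range (nScales β + 1), (Kp m).eval p)
    (ha : ∀ m ≤ nScales β, ∀ j ≤ 4, ∀ q : Momentum, ‖iteratedFDeriv ℝ j (evalM (Kp m)) q‖ ≤ pieceSize R U m j)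
    (d : ℕ)
    {Λ₃ : ℝ} (hΛ₃ : ∀ q : Momentum, ∑ m ∈ Ioc 0 (nScales β), ‖iteratedFDeriv ℝ 3 (evalM (lowPart d (Kp m))) q‖ ≤ Λ₃)
    {Λ₄ : ℝ} (hΛ₄ : ∀ q : Momentum, ∑ m ∈ Ioc 0 (nScales β), ‖iteratedFDeriv ℝ 4 (evalM (lowPart d (Kp m))) q‖ ≤ Λ₄)
    (hc₀ : Continuous (klLocalPart L M β U μ K 0))
    {S : ℕ → TrigPolyC4v}
    (hS : ∀ θ, klLocalPart L M β U μ K 0 θ - K.eval (klFermiPoint μ K θ) = (S (nScales β)).eval (klFermiPoint μ K θ))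
    {dT : ℝ} {σ : ℕ → ℕ → ℝ} (hσnn : ∀ k l, 0 ≤ σ k l)
    (hσ0 : ∀ k ≤ nScales β, ∀ q : Momentum, |frameLevel μ K q| ≤ dT → |evalM (S k) q| ≤ σ k 0)
    (hσ : ∀ k ≤ nScales β, ∀ l, 1 ≤ l → l ≤ 5 → ∀ q : Momentum, |frameLevel μ K q| ≤ dT → ‖iteratedFDeriv ℝ l (evalM (S k)) q‖ ≤ σ k l)
    {ε : ℕ → ℕ → ℝ} (hεnn : ∀ m l, 0 ≤ ε m l)
    (hε0 : ∀ m ∈ Ioc 0 (nScales β), ∀ q : Momentum,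
      |frameLevel μ K q| ≤ dT → |evalM (fsub (S m) (S (m - 1))) q| ≤ ε m 0)
    (hε : ∀ m ∈ Ioc 0 (nScales β), ∀ l, 1 ≤ l → l ≤ 4 → ∀ q : Momentum,
      |frameLevel μ K q| ≤ dT → ‖iteratedFDeriv ℝ l (evalM (fsub (S m) (S (m - 1)))) q‖ ≤ ε m l)
    {X : ℝ} (hX : ∀ l ≤ 4, ∀ x : ℝ, ‖iteratedFDeriv ℝ l salmhoferCutoff x‖ ≤ X)
    {Gl : ℝ} (hGl : ∀ q : Momentum, ‖fderiv ℝ (frameLevel μ K) q‖ ≤ Gl) (hdT : msTubeR R U 0 Gl ≤ dT) :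
    TwoLegSizesMSWith L M β U μ K.eval 0 (msPieceBaseL X σ R U 0 Λ₃ Λ₄) (msPieceSlotL X σ ε R c U d 0 Λ₃ Λ₄) := by
  have hn : 0 ≤ nScales β := Nat.zero_le _
  obtain ⟨-, hA20, hd, ⟨hlo, hhi⟩, -, -⟩ := chain_regime_of_pieces hR hc hcle hU hUle hβmin hβc hμ ha hn
  have he : ∀ m ∈ Ioc 0 (nScales β), ∀ j ≤ 4, ∀ q : Momentum,
      ‖iteratedFDeriv ℝ j (evalM (highPart d (Kp m))) q‖ ≤ msE d (pieceSize R U m) j :=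
    fun m hm j hj q => norm_iteratedFDeriv_evalM_highPart_le_msE d (ha m (Finset.mem_Ioc.mp hm).2) hj q
  have hA : ∀ k ≤ nScales β - 0, ∀ p : Momentum, ∀ j ≤ 2,
      ‖iteratedFDeriv ℝ j (frameShift (msChain d Kp 0 (nScales β) k)) p‖ ≤ msA R c U :=
    fun k hk p j hj => norm_iteratedFDeriv_frameShift_msChain_le_msA d hn hR ha hc hcle hU hUle hβmin hβc hμ rfl hk p hj
  obtain ⟨hdT0, hdT'⟩ := tube_conditions_of_pieces hR U d hd hGl hdT
  exact twoLegSizesMSWith_zero_of_chainF_table_tube hμ hK d hc₀ hS hA hA20 hd hlo hhi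
    (fun k hk k' hk' p => norm_iteratedFDeriv_three_frameShift_msChain_le_L d hn hR ha hΛ₃ hk hk' p)
    (fun k hk k' hk' p => norm_iteratedFDeriv_four_frameShift_msChain_le_L d hn hR ha hΛ₄ hk hk' p)
    hσnn hσ0 hσ hεnn hε0 hε he hX hGl hdT0 (fun m hm => hdT' m hm _ _)

end MS

end Summit.HubbardSuperconductivity.HubbardSuperconductivity.Theorems.KLRegimeSplit

end
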